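import Summits.Ventures.PercRepro.RLSRuleTraces

/-!
# C-025 at q = 3: tools for the types `t ≥ 1` of `R₃⁺` (night-3, gen 3)

Three facts every `t ≥ 1` case of the per-flat inequality needs:

* `not_subset_closure_of_mem_UqG` — the REFINED demand: a demanded `B′ ∈ U_G` has `G ∖ B′ ⊄ cl(E ∖ G)` (else
  `E ∖ B′ ⊆ cl(E ∖ G)` and `ρ(E ∖ B′) < p`);
* `not_line_subset_closure_compl_of_rank` — at `t ≥ 2` no line of the plane lies in `cl(E ∖ G)`: if `ℓ ⊆ F := cl(E ∖ G)`
  and `ρ(ℓ ∪ {g}) = 3` for some `g ∈ G`, then `G ⊆ cl(ℓ ∪ {g}) ⊆ cl(F ∪ {g})`, so `ρ(E) ≤ ρ(F) + 1`;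
* `wPlus_ge_of_mstar_zero'` / `rho3_add_card_dep_le_choose` — the EXACT share: when `m*(S) = 0`,
  `w⁺(G, S) = ρ₃(G ∩ S)/ρ₃(S) ≥ ρ₃(G ∩ S)/D` for every `D ≥ ρ₃(S)`, and `ρ₃(S) ≤ C(|S|, 3) − #(dependent triples inside any `B ⊆ S`)` — the crude
  `C(|S|, 3)` is not enough at `t = 1` for the plane with two `3`-lines (numerically negative margin at `p ≤ 10`).
-/

open scoped Matroid

namespace PercRepro

namespace NightThree

open Finset ThmH PerFlat

variable {α : Type*} [DecidableEq α] {M : Matroid α} [M.Finite]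

/-- A demanded subset `B′ ∈ U_G` has `G ∖ B′ ⊄ cl(E ∖ G)` when `ρ(E ∖ G) < p`. -/
theorem not_subset_closure_of_mem_UqG {G B : Finset α} {p : ℕ} (hB : B ∈ UqG M p 3 G)
    (hlt : M.eRk ((gr M \ G : Finset α) : Set α) < (p : ℕ∞)) :
    ¬ ((G \ B : Finset α) : Set α) ⊆ M.closure ((gr M \ G : Finset α) : Set α) := by
  intro hsub
  unfold UqG at hB
  rw [Finset.mem_filter, mem_Uq] at hB
  obtain ⟨⟨_, _, hBp⟩, _⟩ := hB
  have hsubE : ((gr M \ G : Finset α) : Set α) ⊆ M.E := by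
    rw [← coe_gr M]
    exact Finset.coe_subset.2 Finset.sdiff_subset
  have h1 : ((gr M \ B : Finset α) : Set α) ⊆ M.closure ((gr M \ G : Finset α) : Set α) := by
    intro x hx
    rw [Finset.coe_sdiff] at hx
    by_cases hxG : x ∈ G
    · apply hsub
      rw [Finset.coe_sdiff]
      exact ⟨Finset.mem_coe.2 hxG, hx.2⟩
    · apply M.subset_closure _ hsubE
      rw [Finset.coe_sdiff]
      exact ⟨hx.1, fun h => hxG (Finset.mem_coe.1 h)⟩
  have h2 := M.eRk_mono h1
  rw [M.eRk_closure_eq, hBp] at h2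
  exact absurd (h2.trans_lt hlt) (lt_irrefl _)

/-- If a line `ℓ ⊆ G` with `ρ(ℓ ∪ {g}) = 3` (`g ∈ G`) lies in `F = cl(E ∖ G)`, then `ρ(E) ≤ ρ(E ∖ G) + 1`:
so at `t ≥ 2` no such line lies in `cl(E ∖ G)`. -/
theorem not_line_subset_closure_compl_of_rank {G ℓ : Finset α} {g : α} (hG : G ∈ flatsQ M 3) (hℓG : ℓ ⊆ G)
    (hg : g ∈ G) (hr : M.eRk ((insert g ℓ : Finset α) : Set α) = 3)
    (hlt : M.eRk ((gr M \ G : Finset α) : Set α) + 1 < M.eRank) :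
    ¬ (ℓ : Set α) ⊆ M.closure ((gr M \ G : Finset α) : Set α) := by
  intro hsub
  have hGE : G ⊆ gr M := (mem_flatsQ.1 hG).1
  have hG3 : M.eRk (G : Set α) = 3 := eRk_eq_three_of_mem_flatsQ' hG
  have hsubE : ((gr M \ G : Finset α) : Set α) ⊆ M.E := by
    rw [← coe_gr M]
    exact Finset.coe_subset.2 Finset.sdiff_subset
  set F := M.closure ((gr M \ G : Finset α) : Set α) with hF
  -- `G ⊆ cl(insert g ℓ)`
  have hGcl : (G : Set α) ⊆ M.closure ((insert g ℓ : Finset α) : Set α) := by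
    intro x hx
    by_contra hxc
    have hxE : x ∈ M.E := by
      rw [← coe_gr M]
      exact Finset.mem_coe.2 (hGE (Finset.mem_coe.1 hx))
    have h1 := M.eRk_insert_eq_add_one (X := ((insert g ℓ : Finset α) : Set α)) ⟨hxE, hxc⟩
    have h2 : M.eRk (insert x ((insert g ℓ : Finset α) : Set α)) ≤ M.eRk (G : Set α) := by
      apply M.eRk_mono
      intro y hy
      rcases hy with rfl | hy
      · exact hx
      · rw [Finset.coe_insert] at hy
        rcases hy with rfl | hy
        · exact Finset.mem_coe.2 hg
        · exact Finset.mem_coe.2 (hℓG (Finset.mem_coe.1 hy))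
    rw [h1, hr, hG3] at h2
    exact absurd h2 (by decide)
  -- hence `G ⊆ cl(F ∪ {g})` and `E ⊆ cl(F ∪ {g})`
  have hgF : insert g F ⊆ M.E := by
    rw [Set.insert_subset_iff]
    exact ⟨by rw [← coe_gr M]; exact Finset.mem_coe.2 (hGE hg), M.closure_subset_ground _⟩
  have hins : ((insert g ℓ : Finset α) : Set α) ⊆ M.closure (insert g F) := by
    rw [Finset.coe_insert]
    exact (Set.insert_subset_insert hsub).trans (M.subset_closure _ hgF)
  have hGF : (G : Set α) ⊆ M.closure (insert g F) :=
    hGcl.trans (M.closure_subset_closure_of_subset_closure hins)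
  have hEF : M.E ⊆ M.closure (insert g F) := by
    intro x hx
    by_cases hxG : x ∈ G
    · exact hGF (Finset.mem_coe.2 hxG)
    · have hxF : x ∈ F := by
        apply M.subset_closure _ hsubE
        rw [Finset.coe_sdiff, coe_gr]
        exact ⟨hx, fun h => hxG (Finset.mem_coe.1 h)⟩
      exact M.subset_closure _ hgF (Set.mem_insert_of_mem _ hxF)
  have h1 : M.eRank ≤ M.eRk (insert g F) := by
    rw [← M.eRk_ground, ← M.eRk_closure_eq (insert g F)]
    exact M.eRk_mono hEF
  have h2 : M.eRk (insert g F) ≤ M.eRk F + 1 := by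
    rw [← Set.union_singleton]
    exact (M.eRk_union_le_eRk_add_eRk F {g}).trans (add_le_add le_rfl (by
      have := M.eRk_le_encard ({g} : Set α)
      rwa [Set.encard_singleton] at this))
  rw [hF, M.eRk_closure_eq] at h2
  exact absurd (h1.trans h2) (not_le.2 hlt)

/-- The exact share: with `m*(S) = 0`, `ρ₃(G ∩ S)/D ≤ w⁺(G, S)` for every `D ≥ ρ₃(S)`. -/
theorem wPlus_ge_of_mstar_zero' {S : Finset α} (hS : S ⊆ gr M) (h : mstar M S = 0) (G : Finset α) {D : ℚ}
    (hD : (rho3 M S : ℚ) ≤ D) : (rho3 M (G ∩ S) : ℚ) / D ≤ wPlus M G S := by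
  unfold wPlus
  rw [sum_fPlus_of_mstar_zero hS h, fPlus_of_mstar_zero h]
  rcases Nat.eq_zero_or_pos (rho3 M S) with h0 | hpos
  · have : rho3 M (G ∩ S) = 0 := by
      have h' : rho3 M (G ∩ S) ≤ rho3 M S := rho3_mono Finset.inter_subset_right
      omega
    rw [this]
    simp
  · apply div_le_div_of_nonneg_left (by positivity) (by exact_mod_cast hpos) hD

open scoped Classical in
omit [M.Finite] in
/-- The independent triples of `S` and the dependent triples of `B ⊆ S` are disjoint sets of triples of `S`:
`ρ₃(S) + #dep(B) ≤ C(|S|, 3)`. -/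
theorem rho3_add_card_dep_le_choose {S B : Finset α} (hB : B ⊆ S) :
    rho3 M S + ((B.powersetCard 3).filter (fun (T : Finset α) => ¬ M.Indep (T : Set α))).card ≤ S.card.choose 3 := by
  classical
  unfold rho3
  rw [← Finset.card_powersetCard 3 S]
  have hdisj : Disjoint ((S.powersetCard 3).filter (fun (T : Finset α) => M.Indep (T : Set α)))
      ((B.powersetCard 3).filter (fun (T : Finset α) => ¬ M.Indep (T : Set α))) := by
    rw [Finset.disjoint_left]
    intro T h1 h2
    rw [Finset.mem_filter] at h1 h2
    exact h2.2 h1.2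
  rw [← Finset.card_union_of_disjoint hdisj]
  apply Finset.card_le_card
  apply Finset.union_subset (Finset.filter_subset _ _)
  intro T hT
  rw [Finset.mem_filter, Finset.mem_powersetCard] at hT
  rw [Finset.mem_powersetCard]
  exact ⟨hT.1.1.trans hB, hT.1.2⟩

open scoped Classical in
omit [M.Finite] in
/-- A dependent triple `ℓ ⊆ B ⊆ S` costs one: `ρ₃(S) + 1 ≤ C(|S|, 3)`. -/
theorem rho3_add_one_le_choose {S B ℓ : Finset α} (hB : B ⊆ S) (hℓB : ℓ ⊆ B) (hℓc : ℓ.card = 3)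
    (hℓdep : ¬ M.Indep (ℓ : Set α)) : rho3 M S + 1 ≤ S.card.choose 3 := by
  classical
  have h := rho3_add_card_dep_le_choose (M := M) hB
  have h1 : 1 ≤ ((B.powersetCard 3).filter (fun (T : Finset α) => ¬ M.Indep (T : Set α))).card := by
    apply Finset.card_pos.2
    exact ⟨ℓ, by rw [Finset.mem_filter, Finset.mem_powersetCard]; exact ⟨⟨hℓB, hℓc⟩, hℓdep⟩⟩
  omega

end NightThree

end PercRepro
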